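import Literature.Algebra.Homology.OrderedCechSystem
import Literature.AlgebraicGeometry.Modules.AffineVectorBundleSections
import HarnessLib

/-!
# The ordered Čech complex of an `𝒪_X`-module over a base ring (module dialect; EGA III 6.10 / Mumford AV §5)

For a scheme `X`, a ring homomorphism `ρ : A → Γ(X, 𝒪_X)` (in the applications `X = P ×_K T → T`
affine with `A = Γ(T, 𝒪_T)`), a finite linearly ordered family of opens `𝓥 = (V_i)_{i ∈ ι}` and an
`𝒪_X`-module `L`, the **module Čech complex** `Č•(𝓥, L)` is the ordered Čech complex
(`Literature/Algebra/Homology/OrderedCechSystem`: `OrderedCech.sysComplex`) of the SYSTEM of `A`-modules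
`s ↦ Γ(L, V_s)`, `V_s = ⋂_{i ∈ s} V_i`, with the restriction maps of `L` (Görtz–Wedhorn II, Def. 21.68;
Mumford, *Abelian Varieties*, §5: "the Čech complex `C•` of `𝓕` with respect to an affine covering is a
complex of `A`-flat modules"). Unlike the function-field model `Motives/CartierDivisorCech` (sections
`Γ(W_s, 𝒪_Y(D)) ⊆ K(Y)` on an INTEGRAL scheme) this model makes sense on non-reduced, reducible `X`
— the test schemes of the scheme-theoretic seesaw theorem (Görtz–Wedhorn II, Thm. 24.66).

* `Modules.cechOpen 𝓥 s = ⋂_{i ∈ s} V_i`; `Modules.toSections ρ U : A →+* Γ(X, U)`;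
  `Modules.SecMod L ρ U = Γ(L, U)` as an `A`-MODULE through `ρ` (`Module.compHom`), `SecMod.smul_def`;
  the `A`-linear restrictions `Modules.SecMod.res`;
* `Modules.sectionsSystem 𝓥 L ρ : Finset ι ⥤ ModuleCat A` and
  **`Modules.cechComplex 𝓥 L ρ := OrderedCech.sysComplex (sectionsSystem 𝓥 L ρ)`** (shape `[0, #ι-1]`);
* **flat terms**: `Modules.flat_secMod_of_isFiniteLocallyFree` — `Γ(L, U)` is `A`-flat for `U` affine,
  `L` finite locally free and `Γ(X, U)` flat over `A` (sections of a vector bundle over an affine are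
  projective, `Modules/AffineVectorBundleSections.finite_projective_sections_of_isFiniteLocallyFree`;
  Görtz–Wedhorn I, Cor. 7.42), and `Modules.flat_cechComplex_X`.

The identification `Ȟ⁰ = Γ(X, L)` is the sequel `Modules/ModuleCechHZero`. Everything is proved; no named facts.
Mathlib searched (pin): `Scheme.Modules.map_smul`, `Module.compHom`, `Module.Flat.trans` (used); Mathlib has no
Čech complex of a sheaf of modules on a scheme (`CategoryTheory/Sites/SheafCohomology/Cech` is the full complex of
a presheaf of abelian groups).  Cell `hodgecm-mathlib`, M13 node N1 (1a-α) (B-p10 (g8), cut/couriered by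
B-p15 (g8) per B-plan1 R140); generic, books 0.

## References

* U. Görtz, T. Wedhorn, *Algebraic Geometry II: Cohomology of Schemes* (2023), Def. 21.64, Lemma 21.65,
  Def. 21.68 (pp. 179–180); Thm. 22.9 (p. 236); Thm. 24.66 (p. 405). [GortzWedhorn2023]
* U. Görtz, T. Wedhorn, *Algebraic Geometry I: Schemes*, 2nd ed. (2020), Cor. 7.42. [GortzWedhorn2020]
* A. Grothendieck, EGA III₂ (Publ. Math. IHÉS 17, 1963), (6.10.2)–(6.10.5). [EGA3]
* D. Mumford, *Abelian Varieties*, TIFR Studies in Mathematics 5 (1970), §5. [MumfordAV1970]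
-/

universe u

open CategoryTheory AlgebraicGeometry TopologicalSpace Opposite
open Literature.Algebra.Homology Literature.AlgebraicGeometry.Motives

set_option backward.isDefEq.respectTransparency false

noncomputable section

namespace Literature.AlgebraicGeometry.Modules

variable {X : Scheme.{u}} {ι : Type} (𝓥 : ι → X.Opens) (L : X.Modules)
variable {A : Type u} [CommRing A] (ρ : A →+* Γ(X, ⊤))

/-! ### The opens `V_s` -/

/-- The open `V_s = ⋂_{i ∈ s} V_i` of a finite set of indices (`V_∅ = X`), as the finite infimum
`s.inf 𝓥` in the lattice of opens (so that it commutes with preimages). [cite: GortzWedhorn2023, Def. 21.64 (p. 179)] -/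
def cechOpen (s : Finset ι) : X.Opens := s.inf 𝓥

/-- `V_s ≤ V_i` for `i ∈ s`. [folklore] [cite: GortzWedhorn2023, Def. 21.68 (p. 180)] -/
theorem cechOpen_le {s : Finset ι} {i : ι} (hi : i ∈ s) : cechOpen 𝓥 s ≤ 𝓥 i := Finset.inf_le hi

/-- `V_t ≤ V_s` for `s ⊆ t`. [folklore] [cite: GortzWedhorn2023, Def. 21.68 (p. 180)] -/
theorem cechOpen_anti {s t : Finset ι} (h : s ⊆ t) : cechOpen 𝓥 t ≤ cechOpen 𝓥 s :=
  Finset.inf_mono h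

/-- `V_{{i}} = V_i`. [folklore] [cite: GortzWedhorn2023, Def. 21.68 (p. 180)] -/
theorem cechOpen_singleton (i : ι) : cechOpen 𝓥 {i} = 𝓥 i := Finset.inf_singleton

/-- `V_{{i,j}} = V_i ⊓ V_j`. [folklore] [cite: GortzWedhorn2023, Def. 21.68 (p. 180)] -/
theorem cechOpen_pair [DecidableEq ι] (i j : ι) : cechOpen 𝓥 {i, j} = 𝓥 i ⊓ 𝓥 j := by
  unfold cechOpen
  rw [Finset.inf_insert, Finset.inf_singleton]

/-- `V_∅ = X`. [folklore] [cite: GortzWedhorn2023, Def. 21.68 (p. 180)] -/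
@[simp] theorem cechOpen_empty : cechOpen 𝓥 ∅ = ⊤ := Finset.inf_empty

/-- **Preimages commute with the `V_s`**: `f⁻¹(V_s) = ⋂_{i ∈ s} f⁻¹(V_i)`. [folklore] [cite: GortzWedhorn2023, Def. 21.68 (p. 180)] -/
theorem preimage_cechOpen {Y : Scheme.{u}} (f : Y ⟶ X) (s : Finset ι) :
    f ⁻¹ᵁ cechOpen 𝓥 s = cechOpen (fun i => f ⁻¹ᵁ 𝓥 i) s := by
  classical
  unfold cechOpen
  induction s using Finset.induction_on with
  | empty => rfl
  | insert a s ha ih => rw [Finset.inf_insert, Finset.inf_insert, ← ih]; rfl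

/-! ### Sections as `A`-modules through `ρ` -/

/-- The structure map `A → Γ(X, 𝒪_X) → Γ(U, 𝒪_X)`. [folklore] [cite: GortzWedhorn2023, Def. 21.68 (p. 180)] -/
def toSections (U : X.Opens) : A →+* Γ(X, U) :=
  (X.presheaf.map (homOfLE le_top).op).hom.comp ρ

/-- Compatibility of the structure maps with restriction. [folklore] [cite: GortzWedhorn2023, Def. 21.68 (p. 180)] -/
theorem resO_toSections {U W : X.Opens} (h : W ≤ U) (a : A) :
    X.presheaf.map (homOfLE h).op (toSections ρ U a) = toSections ρ W a := by
  change (X.presheaf.map (homOfLE le_top).op ≫ X.presheaf.map (homOfLE h).op) (ρ a) = _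
  rw [← Functor.map_comp, ← op_comp]
  rfl

/-- **`Γ(L, U)` as a type to carry the `A`-module structure through `ρ`** (a definition, so that the
`Module.compHom` instance does not compete with the `Γ(X, U)`-module structure of Mathlib). [folklore] [cite: GortzWedhorn2023, Def. 21.68 (p. 180)] -/
def SecMod (_ρ : A →+* Γ(X, ⊤)) (U : X.Opens) : Type u := Γ(L, U)

namespace SecMod

variable {L ρ}

/-- The identification `Γ(L, U) → SecMod L ρ U`. [folklore] [cite: GortzWedhorn2023, Def. 21.68 (p. 180)] -/
def mk {U : X.Opens} (x : Γ(L, U)) : SecMod L ρ U := x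

/-- The identification `SecMod L ρ U → Γ(L, U)`. [folklore] [cite: GortzWedhorn2023, Def. 21.68 (p. 180)] -/
def val {U : X.Opens} (x : SecMod L ρ U) : Γ(L, U) := x

/-- `val (mk x) = x`. [folklore] [cite: GortzWedhorn2023, Def. 21.68 (p. 180)] -/
@[simp] theorem val_mk {U : X.Opens} (x : Γ(L, U)) : val (mk (ρ := ρ) x) = x := rfl

/-- `mk (val x) = x`. [folklore] [cite: GortzWedhorn2023, Def. 21.68 (p. 180)] -/
@[simp] theorem mk_val {U : X.Opens} (x : SecMod L ρ U) : mk (val x) = x := rfl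

variable (L ρ)

/-- `SecMod L ρ U` is an abelian group (that of `Γ(L, U)`). [folklore] [cite: GortzWedhorn2023, Def. 21.68 (p. 180)] -/
instance instAddCommGroup (U : X.Opens) : AddCommGroup (SecMod L ρ U) :=
  inferInstanceAs (AddCommGroup Γ(L, U))

/-- **The `A`-module structure on `Γ(L, U)` through `ρ`**: `a • x = ρ(a)|_U • x`. [folklore] [cite: GortzWedhorn2023, Def. 21.68 (p. 180)] -/
instance instModule (U : X.Opens) : Module A (SecMod L ρ U) :=
  Module.compHom Γ(L, U) (toSections ρ U)

variable {L ρ}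

/-- The scalar multiplication through `ρ`, unfolded. [folklore] [cite: GortzWedhorn2023, Def. 21.68 (p. 180)] -/
theorem smul_def {U : X.Opens} (a : A) (x : SecMod L ρ U) :
    val (a • x) = toSections ρ U a • val x := rfl

/-- `val` is additive. [folklore] [cite: GortzWedhorn2023, Def. 21.68 (p. 180)] -/
@[simp] theorem val_add {U : X.Opens} (x y : SecMod L ρ U) : val (x + y) = val x + val y := rfl

/-- `val 0 = 0`. [folklore] [cite: GortzWedhorn2023, Def. 21.68 (p. 180)] -/
@[simp] theorem val_zero {U : X.Opens} : val (0 : SecMod L ρ U) = 0 := rfl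

/-- `val` is injective. [folklore] [cite: GortzWedhorn2023, Def. 21.68 (p. 180)] -/
theorem val_injective {U : X.Opens} : Function.Injective (val : SecMod L ρ U → Γ(L, U)) := fun _ _ h => h

variable (L ρ)

/-- **The `A`-linear restriction `Γ(L, U) → Γ(L, W)`** (`W ≤ U`). [folklore] [cite: GortzWedhorn2023, Def. 21.68 (p. 180)] -/
def res {U W : X.Opens} (h : W ≤ U) : SecMod L ρ U →ₗ[A] SecMod L ρ W where
  toFun x := mk (L.presheaf.map (homOfLE h).op (val x))
  map_add' x y := by
    change mk (L.presheaf.map (homOfLE h).op (val x + val y)) = _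
    rw [map_add]
    rfl
  map_smul' a x := by
    apply val_injective
    change L.presheaf.map (homOfLE h).op (toSections ρ U a • val x) = toSections ρ W a • _
    rw [Scheme.Modules.map_smul, resO_toSections]
    rfl

variable {L ρ}

/-- The restriction on underlying sections. [folklore] [cite: GortzWedhorn2023, Def. 21.68 (p. 180)] -/
@[simp] theorem val_res {U W : X.Opens} (h : W ≤ U) (x : SecMod L ρ U) :
    val (res L ρ h x) = L.presheaf.map (homOfLE h).op (val x) := rfl

/-- Restriction along `U ≤ U` is the identity. [folklore] [cite: GortzWedhorn2023, Def. 21.68 (p. 180)] -/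
theorem res_self {U : X.Opens} (h : U ≤ U) (x : SecMod L ρ U) : res L ρ h x = x := by
  apply val_injective
  rw [val_res]
  have : homOfLE h = 𝟙 U := Subsingleton.elim _ _
  rw [this, op_id, L.presheaf.map_id]
  rfl

/-- Transitivity of restriction. [folklore] [cite: GortzWedhorn2023, Def. 21.68 (p. 180)] -/
theorem res_res {U W Y : X.Opens} (h : W ≤ U) (h' : Y ≤ W) (x : SecMod L ρ U) :
    res L ρ h' (res L ρ h x) = res L ρ (h'.trans h) x := by
  apply val_injective
  rw [val_res, val_res, val_res]
  change (L.presheaf.map (homOfLE h).op ≫ L.presheaf.map (homOfLE h').op) (val x) = _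
  rw [← Functor.map_comp, ← op_comp]
  rfl

/-- Restrictions along equal composites agree (proof irrelevance packaged for rewriting). [folklore] [cite: GortzWedhorn2023, Def. 21.68 (p. 180)] -/
theorem res_congr {U W : X.Opens} (h h' : W ≤ U) (x : SecMod L ρ U) : res L ρ h x = res L ρ h' x := rfl

end SecMod

/-! ### The system of sections and the module Čech complex -/

/-- **The system of `A`-modules `s ↦ Γ(L, V_s)`** on the finite subsets of `ι`, with the restriction
maps of `L`. [cite: GortzWedhorn2023, Def. 21.64 (p. 179)] -/
def sectionsSystem : Finset ι ⥤ ModuleCat.{u} A where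
  obj s := ModuleCat.of A (SecMod L ρ (cechOpen 𝓥 s))
  map {s t} h := ModuleCat.ofHom (SecMod.res L ρ (cechOpen_anti 𝓥 h.le))
  map_id s := by
    ext x
    exact SecMod.res_self _ x
  map_comp {s t r} f g := by
    ext x
    change SecMod.res L ρ _ x = SecMod.res L ρ _ (SecMod.res L ρ _ x)
    rw [SecMod.res_res]

/-- The objects of the system. [folklore] [cite: GortzWedhorn2023, Def. 21.68 (p. 180)] -/
@[simp] theorem sectionsSystem_obj (s : Finset ι) :
    (sectionsSystem 𝓥 L ρ).obj s = ModuleCat.of A (SecMod L ρ (cechOpen 𝓥 s)) := rfl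

/-- The maps of the system are the restrictions. [folklore] [cite: GortzWedhorn2023, Def. 21.68 (p. 180)] -/
theorem sectionsSystem_map_apply {s t : Finset ι} (h : s ⟶ t) (x : SecMod L ρ (cechOpen 𝓥 s)) :
    ((sectionsSystem 𝓥 L ρ).map h).hom x = SecMod.res L ρ (cechOpen_anti 𝓥 h.le) x := rfl

variable [LinearOrder ι]

/-- **The module Čech complex `Č•(𝓥, L)` of `A`-modules** (ordered; Görtz–Wedhorn II, Def. 21.68, for the
system of sections). [cite: GortzWedhorn2023, Def. 21.68 (p. 180)] -/
abbrev cechComplex : CochainComplex (ModuleCat.{u} A) ℤ :=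
  OrderedCech.sysComplex (sectionsSystem 𝓥 L ρ)

/-- The module Čech complex is concentrated in degrees `≥ 0`. [folklore] [cite: GortzWedhorn2023, Def. 21.68 (p. 180)] -/
theorem isStrictlyGE_cechComplex : (cechComplex 𝓥 L ρ).IsStrictlyGE 0 :=
  OrderedCech.isStrictlyGE_sysComplex _

/-- The module Čech complex is concentrated in degrees `≤ r` when `#ι ≤ r + 1`. [folklore] [cite: GortzWedhorn2023, Def. 21.68 (p. 180)] -/
theorem isStrictlyLE_cechComplex [Fintype ι] (r : ℤ) (hr : (Fintype.card ι : ℤ) ≤ r + 1) :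
    (cechComplex 𝓥 L ρ).IsStrictlyLE r :=
  OrderedCech.isStrictlyLE_sysComplex_of_card_le _ r hr

/-! ### Flat terms -/

/-- The `Γ(X, U)`-module `Γ(L, U)` viewed on `SecMod` (Mathlib's instance transported along the identity).
[folklore] [cite: GortzWedhorn2023, Def. 21.68 (p. 180)] -/
instance SecMod.instModuleSections (U : X.Opens) : Module Γ(X, U) (SecMod L ρ U) :=
  inferInstanceAs (Module Γ(X, U) Γ(L, U))

/-- The two module structures on `SecMod L ρ U` form a scalar tower along `toSections ρ U`. [folklore] [cite: GortzWedhorn2023, Def. 21.68 (p. 180)] -/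
theorem SecMod.isScalarTower (U : X.Opens) :
    letI : Algebra A Γ(X, U) := (toSections ρ U).toAlgebra
    IsScalarTower A Γ(X, U) (SecMod L ρ U) := by
  letI : Algebra A Γ(X, U) := (toSections ρ U).toAlgebra
  exact ⟨fun a r x => by
    change (toSections ρ U a * r) • SecMod.val x = toSections ρ U a • (r • SecMod.val x)
    rw [mul_smul]⟩

/-- **`Γ(L, U)` is a flat `A`-module** for `U` affine, `L` finite locally free and `Γ(X, U)` flat over
`A` (through `toSections ρ U`): sections of a vector bundle over an affine open are projective
(Görtz–Wedhorn I, Cor. 7.42), and flatness is transitive. [cite: GortzWedhorn2020, Cor. 7.42] -/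
theorem flat_secMod_of_isFiniteLocallyFree {U : X.Opens} (hU : IsAffineOpen U) (hL : IsFiniteLocallyFree L)
    (hflat : letI : Algebra A Γ(X, U) := (toSections ρ U).toAlgebra; Module.Flat A Γ(X, U)) :
    Module.Flat A (SecMod L ρ U) := by
  letI : Algebra A Γ(X, U) := (toSections ρ U).toAlgebra
  haveI := SecMod.isScalarTower L ρ U
  haveI : Module.Flat A Γ(X, U) := hflat
  haveI : Module.Projective Γ(X, U) (SecMod L ρ U) :=
    (finite_projective_sections_of_isFiniteLocallyFree hL hU).2
  haveI : Module.Flat Γ(X, U) (SecMod L ρ U) := Module.Flat.of_projective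
  exact Module.Flat.trans A Γ(X, U) (SecMod L ρ U)

/-- **The terms of the module Čech complex are flat** when the `Γ(L, V_s)` (`s ≠ ∅`) are. [folklore] [cite: GortzWedhorn2023, Def. 21.68 (p. 180)] -/
theorem flat_cechComplex_X [Fintype ι]
    (hflat : ∀ s : Finset ι, s.Nonempty → Module.Flat A (SecMod L ρ (cechOpen 𝓥 s))) (n : ℤ) :
    Module.Flat A ((cechComplex 𝓥 L ρ).X n) :=
  OrderedCech.flat_sysComplex_X _ hflat n

/-- **Flat terms, geometric form**: all `V_s` (`s ≠ ∅`) affine, `L` finite locally free, and every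
`Γ(X, V_s)` flat over `A` (e.g. `X → Spec A` flat). [cite: MumfordAV1970, §5] -/
theorem flat_cechComplex_X_of_isFiniteLocallyFree [Fintype ι]
    (hV : ∀ s : Finset ι, s.Nonempty → IsAffineOpen (cechOpen 𝓥 s)) (hL : IsFiniteLocallyFree L)
    (hflat : ∀ s : Finset ι, s.Nonempty →
      letI : Algebra A Γ(X, cechOpen 𝓥 s) := (toSections ρ (cechOpen 𝓥 s)).toAlgebra
      Module.Flat A Γ(X, cechOpen 𝓥 s)) (n : ℤ) :
    Module.Flat A ((cechComplex 𝓥 L ρ).X n) :=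
  flat_cechComplex_X 𝓥 L ρ (fun s hs => flat_secMod_of_isFiniteLocallyFree L ρ (hV s hs) hL (hflat s hs)) n

end Literature.AlgebraicGeometry.Modules

end
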